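import Mathlib.Analysis.Calculus.Gradient.Basic
import Summits.NavierStokesRegularity.NavierStokesRegularity.Theorems.SelfMixingDichotomyMixingPayoffAdvectionDiffusionClock
import Summits.NavierStokesRegularity.NavierStokesRegularity.Theorems.SelfMixingDichotomyMixingPayoffAdvectionDiffusionAniso
import HarnessLib

/-!
# Crux `MixingPayoff` (stmt-NavierStokesRegularity-1422), line `birth`, stub W2
  (`stub_advectionDiffusionSchwartz`): `C_b^∞` calculus for the conjugated coefficients

Helper file (lands `--supports stmt-NavierStokesRegularity-1422`). Conjugating the
advection–diffusion equation `∂ₜθ + ⟪v, ∇θ⟫ = Δθ` by an exponential weight, `θ = e^{-w} ψ`,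
gives for `ψ` the linear equation `∂ₜψ = Δψ + Dψ[β] + γψ` with

  `β = −(v + 2∇w)`,  `γ = ⟪v, ∇w⟫ + ‖∇w‖² − Δw`.

This file proves that `β`, `γ` are jointly `C^∞` with ALL derivatives bounded when `v` is
(on `ℝ × E`) and `w` is smooth with all derivatives of order `≥ 1` bounded
(`conj_coefficients`): closure of "smooth with all derivatives bounded" under composition with
the projection `(t, x) ↦ x`, sums, negation, the inner product (Leibniz bounds of
`…AdvectionDiffusionClock`), the gradient of `w` and the Laplacian of `w`. It also records that
the conjugated datum `e^{w} θ₀` of a `C_c^∞` datum has all derivatives bounded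
(`isCkBounded_exp_mul`).
-/

noncomputable section

open Set Function Filter Topology
open scoped ContDiff Topology InnerProductSpace Laplacian

-- `Summit = Problem` for this summit; the tree lakefile sets `weak.linter.dupNamespace = false`.
set_option linter.dupNamespace false

namespace Summit.NavierStokesRegularity.NavierStokesRegularity.Theorems.SelfMixingDichotomy.MixingPayoffBirth

open Literature.Analysis.FluidPDE

-- nested operator types
set_option maxSynthPendingDepth 3

section CbCalculus

variable {X : Type*} [NormedAddCommGroup X] [NormedSpace ℝ X]
variable {W : Type*} [NormedAddCommGroup W] [NormedSpace ℝ W]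
variable {W' : Type*} [NormedAddCommGroup W'] [NormedSpace ℝ W']

/-- Post-composition with a continuous linear map preserves bounded derivatives. -/
theorem cb_clm_comp (L : W →L[ℝ] W') {F : X → W} (hF : ContDiff ℝ ∞ F)
    (hFb : ∀ n, ∃ C, ∀ p, ‖iteratedFDeriv ℝ n F p‖ ≤ C) :
    ContDiff ℝ ∞ (fun p => L (F p)) ∧ ∀ n, ∃ C, ∀ p, ‖iteratedFDeriv ℝ n (fun p => L (F p)) p‖ ≤ C := by
  refine ⟨L.contDiff.comp hF, fun n => ?_⟩
  obtain ⟨C, hC⟩ := hFb n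
  refine ⟨‖L‖ * C, fun p => ?_⟩
  rw [show (fun p => L (F p)) = L ∘ F from rfl]
  exact (L.norm_iteratedFDeriv_comp_left hF.contDiffAt (n := n) (mod_cast le_top)).trans
    (mul_le_mul_of_nonneg_left (hC p) (norm_nonneg _))

/-- Pre-composition with a continuous linear map preserves bounded derivatives. -/
theorem cb_comp_clm {Y : Type*} [NormedAddCommGroup Y] [NormedSpace ℝ Y] (A : Y →L[ℝ] X)
    {F : X → W} (hF : ContDiff ℝ ∞ F) (hFb : ∀ n, ∃ C, ∀ p, ‖iteratedFDeriv ℝ n F p‖ ≤ C) :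
    ContDiff ℝ ∞ (fun p => F (A p)) ∧ ∀ n, ∃ C, ∀ p, ‖iteratedFDeriv ℝ n (fun p => F (A p)) p‖ ≤ C := by
  refine ⟨hF.comp A.contDiff, fun n => ?_⟩
  obtain ⟨C, hC⟩ := norm_iteratedFDeriv_comp_clm_le_uniform hF hFb A n
  exact ⟨C, fun p => hC n le_rfl p⟩

/-- Sums preserve bounded derivatives. -/
theorem cb_add {F G : X → W} (hF : ContDiff ℝ ∞ F) (hFb : ∀ n, ∃ C, ∀ p, ‖iteratedFDeriv ℝ n F p‖ ≤ C)
    (hG : ContDiff ℝ ∞ G) (hGb : ∀ n, ∃ C, ∀ p, ‖iteratedFDeriv ℝ n G p‖ ≤ C) :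
    ContDiff ℝ ∞ (fun p => F p + G p) ∧ ∀ n, ∃ C, ∀ p, ‖iteratedFDeriv ℝ n (fun p => F p + G p) p‖ ≤ C := by
  refine ⟨hF.add hG, fun n => ?_⟩
  obtain ⟨C, hC⟩ := hFb n
  obtain ⟨D, hD⟩ := hGb n
  refine ⟨C + D, fun p => ?_⟩
  rw [show (fun p => F p + G p) = F + G from rfl,
    iteratedFDeriv_add_apply (hF.contDiffAt.of_le (mod_cast le_top)) (hG.contDiffAt.of_le (mod_cast le_top))]
  exact (norm_add_le _ _).trans (add_le_add (hC p) (hD p))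

/-- Negation preserves bounded derivatives. -/
theorem cb_neg {F : X → W} (hF : ContDiff ℝ ∞ F) (hFb : ∀ n, ∃ C, ∀ p, ‖iteratedFDeriv ℝ n F p‖ ≤ C) :
    ContDiff ℝ ∞ (fun p => -F p) ∧ ∀ n, ∃ C, ∀ p, ‖iteratedFDeriv ℝ n (fun p => -F p) p‖ ≤ C := by
  refine ⟨hF.neg, fun n => ?_⟩
  obtain ⟨C, hC⟩ := hFb n
  refine ⟨C, fun p => ?_⟩
  rw [show (fun p => -F p) = -F from rfl, iteratedFDeriv_neg_apply, norm_neg]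
  exact hC p

/-- Continuous bilinear maps preserve bounded derivatives. -/
theorem cb_bilin {W₁ W₂ W₃ : Type*} [NormedAddCommGroup W₁] [NormedSpace ℝ W₁] [NormedAddCommGroup W₂]
    [NormedSpace ℝ W₂] [NormedAddCommGroup W₃] [NormedSpace ℝ W₃] (B : W₁ →L[ℝ] W₂ →L[ℝ] W₃)
    {F : X → W₁} {G : X → W₂} (hF : ContDiff ℝ ∞ F) (hFb : ∀ n, ∃ C, ∀ p, ‖iteratedFDeriv ℝ n F p‖ ≤ C)
    (hG : ContDiff ℝ ∞ G) (hGb : ∀ n, ∃ C, ∀ p, ‖iteratedFDeriv ℝ n G p‖ ≤ C) :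
    ContDiff ℝ ∞ (fun p => B (F p) (G p)) ∧
      ∀ n, ∃ C, ∀ p, ‖iteratedFDeriv ℝ n (fun p => B (F p) (G p)) p‖ ≤ C := by
  refine ⟨(B.contDiff.comp hF).clm_apply hG, fun n => ?_⟩
  choose CF hCF using hFb
  choose CG hCG using hGb
  set Cf : ℝ := ∑ i ∈ Finset.range (n + 1), |CF i| with hCf
  set Cg : ℝ := ∑ i ∈ Finset.range (n + 1), |CG i| with hCg
  have h1 : ∀ i ≤ n, ∀ p ∈ (univ : Set X), ‖iteratedFDeriv ℝ i F p‖ ≤ Cf := fun i hi p _ =>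
    ((hCF i p).trans (le_abs_self _)).trans (Finset.single_le_sum (f := fun i => |CF i|)
      (fun _ _ => abs_nonneg _) (Finset.mem_range.2 (Nat.lt_succ_of_le hi)))
  have h2 : ∀ i ≤ n, ∀ p ∈ (univ : Set X), ‖iteratedFDeriv ℝ i G p‖ ≤ Cg := fun i hi p _ =>
    ((hCG i p).trans (le_abs_self _)).trans (Finset.single_le_sum (f := fun i => |CG i|)
      (fun _ _ => abs_nonneg _) (Finset.mem_range.2 (Nat.lt_succ_of_le hi)))
  have h := norm_iteratedFDeriv_bilinear_le_uniform B hF hG h1 h2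
  exact ⟨_, fun p => h n le_rfl p (mem_univ p)⟩

/-- Directional derivatives of a function with bounded derivatives of positive order have
bounded derivatives: `‖Dⁿ (DF · v)‖ ≤ ‖v‖ ‖Dⁿ⁺¹ F‖`. -/
theorem cb_fderiv {F : X → W} (hF : ContDiff ℝ ∞ F)
    (hFb : ∀ k, ∃ C, ∀ p, ‖iteratedFDeriv ℝ (k + 1) F p‖ ≤ C) :
    ContDiff ℝ ∞ (fderiv ℝ F) ∧ ∀ n, ∃ C, ∀ p, ‖iteratedFDeriv ℝ n (fderiv ℝ F) p‖ ≤ C := by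
  refine ⟨hF.fderiv_right (mod_cast le_top), fun n => ?_⟩
  obtain ⟨C, hC⟩ := hFb n
  exact ⟨C, fun p => by rw [norm_iteratedFDeriv_fderiv]; exact hC p⟩

end CbCalculus

section Conjugation

variable {E : Type} [NormedAddCommGroup E] [InnerProductSpace ℝ E] [FiniteDimensional ℝ E]

/-- The gradient is the Fréchet derivative read through the Riesz isometry. -/
theorem gradient_eq_toDual_symm_comp (w : E → ℝ) :
    gradient w = fun x => (InnerProductSpace.toDual ℝ E).symm (fderiv ℝ w x) := rfl

/-- **The gradient of a function with bounded derivatives of positive order is `C_b^∞`.** -/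
theorem cb_gradient {w : E → ℝ} (hw : ContDiff ℝ ∞ w)
    (hwb : ∀ k, ∃ C, ∀ x, ‖iteratedFDeriv ℝ (k + 1) w x‖ ≤ C) :
    ContDiff ℝ ∞ (gradient w) ∧ ∀ n, ∃ C, ∀ x, ‖iteratedFDeriv ℝ n (gradient w) x‖ ≤ C := by
  obtain ⟨h1, h2⟩ := cb_fderiv hw hwb
  have h := cb_clm_comp ((InnerProductSpace.toDual ℝ E).symm : (E →L[ℝ] ℝ) →L[ℝ] E) h1 h2
  rw [gradient_eq_toDual_symm_comp]
  exact h

/-- **The Laplacian of a function with bounded derivatives of positive order is `C_b^∞`**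
(`Δw = tr D(Dw)`, `laplacian_eq_sum_fderiv_fderiv`). -/
theorem cb_laplacian {w : E → ℝ} (hw : ContDiff ℝ ∞ w)
    (hwb : ∀ k, ∃ C, ∀ x, ‖iteratedFDeriv ℝ (k + 1) w x‖ ≤ C) :
    ContDiff ℝ ∞ (Δ w) ∧ ∀ n, ∃ C, ∀ x, ‖iteratedFDeriv ℝ n (Δ w) x‖ ≤ C := by
  classical
  obtain ⟨h1, h2⟩ := cb_fderiv hw hwb
  have h2' : ∀ k, ∃ C, ∀ p, ‖iteratedFDeriv ℝ (k + 1) (fderiv ℝ w) p‖ ≤ C := fun k => h2 (k + 1)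
  obtain ⟨h3, h4⟩ := cb_fderiv h1 h2'
  set e := stdOrthonormalBasis ℝ E with he
  set Ltr : (E →L[ℝ] E →L[ℝ] ℝ) →L[ℝ] ℝ :=
    ∑ i, (ContinuousLinearMap.apply ℝ ℝ (e i)).comp (ContinuousLinearMap.apply ℝ (E →L[ℝ] ℝ) (e i))
    with hLtr
  have hLtr_apply : ∀ A : E →L[ℝ] E →L[ℝ] ℝ, Ltr A = ∑ i, A (e i) (e i) := fun A => by simp [hLtr]
  have hfun : (Δ w) = fun x => Ltr (fderiv ℝ (fderiv ℝ w) x) := by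
    funext x; rw [hLtr_apply, laplacian_eq_sum_fderiv_fderiv]
  rw [hfun]
  exact cb_clm_comp Ltr h3 h4

set_option maxHeartbeats 400000 in
/-- **The conjugated coefficients are `C_b^∞`.** For `v` jointly `C^∞` on `ℝ × E` with all
derivatives bounded and `w : E → ℝ` smooth with all derivatives of order `≥ 1` bounded, the
fields `β(t, x) = −(v(t, x) + 2∇w(x))` and `γ(t, x) = ⟪v(t, x), ∇w(x)⟫ + ‖∇w(x)‖² − Δw(x)` are
jointly `C^∞` with all derivatives bounded. -/
theorem conj_coefficients {v : ℝ → E → E} (hv : ContDiff ℝ ∞ (uncurry v))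
    (hvb : ∀ n, ∃ C, ∀ p, ‖iteratedFDeriv ℝ n (uncurry v) p‖ ≤ C) {w : E → ℝ} (hw : ContDiff ℝ ∞ w)
    (hwb : ∀ k, ∃ C, ∀ x, ‖iteratedFDeriv ℝ (k + 1) w x‖ ≤ C) {β : ℝ → E → E} {γ : ℝ → E → ℝ}
    (hβ : β = fun t x => -(v t x + (2 : ℝ) • gradient w x))
    (hγ : γ = fun t x => ⟪v t x, gradient w x⟫_ℝ + ⟪gradient w x, gradient w x⟫_ℝ - (Δ w) x) :
    (ContDiff ℝ ∞ (uncurry β) ∧ ∀ n, ∃ C, ∀ p, ‖iteratedFDeriv ℝ n (uncurry β) p‖ ≤ C) ∧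
      (ContDiff ℝ ∞ (uncurry γ) ∧ ∀ n, ∃ C, ∀ p, ‖iteratedFDeriv ℝ n (uncurry γ) p‖ ≤ C) := by
  obtain ⟨hg, hgb⟩ := cb_gradient hw hwb
  obtain ⟨hL, hLb⟩ := cb_laplacian hw hwb
  -- the fields on `ℝ × E`
  obtain ⟨hG, hGb⟩ := cb_comp_clm (ContinuousLinearMap.snd ℝ ℝ E) hg hgb
  obtain ⟨hLs, hLsb⟩ := cb_comp_clm (ContinuousLinearMap.snd ℝ ℝ E) hL hLb
  obtain ⟨hG2, hG2b⟩ := cb_clm_comp ((2 : ℝ) • ContinuousLinearMap.id ℝ E) hG hGb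
  constructor
  · obtain ⟨hs, hsb⟩ := cb_add hv hvb hG2 hG2b
    obtain ⟨hn, hnb⟩ := cb_neg hs hsb
    have hfun : uncurry β = fun p : ℝ × E => -(uncurry v p +
        ((2 : ℝ) • ContinuousLinearMap.id ℝ E) (gradient w ((ContinuousLinearMap.snd ℝ ℝ E) p))) := by
      funext p; simp [hβ, uncurry]
    rw [hfun]; exact ⟨hn, hnb⟩
  · obtain ⟨hi1, hi1b⟩ := cb_bilin (innerSL ℝ (E := E)) hv hvb hG hGb
    obtain ⟨hi2, hi2b⟩ := cb_bilin (innerSL ℝ (E := E)) hG hGb hG hGb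
    obtain ⟨hs, hsb⟩ := cb_add hi1 hi1b hi2 hi2b
    obtain ⟨hn, hnb⟩ := cb_neg hLs hLsb
    obtain ⟨hf, hfb⟩ := cb_add hs hsb hn hnb
    have hfun : uncurry γ = fun p : ℝ × E =>
        (innerSL ℝ (uncurry v p)) (gradient w ((ContinuousLinearMap.snd ℝ ℝ E) p)) +
          (innerSL ℝ (gradient w ((ContinuousLinearMap.snd ℝ ℝ E) p)))
            (gradient w ((ContinuousLinearMap.snd ℝ ℝ E) p)) +
        -(Δ w) ((ContinuousLinearMap.snd ℝ ℝ E) p) := by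
      funext p; simp [hγ, uncurry, sub_eq_add_neg]
    rw [hfun]; exact ⟨hf, hfb⟩

omit [FiniteDimensional ℝ E] in
/-- **The conjugated datum.** For `θ₀ ∈ C_c^∞` and `w` smooth, `x ↦ e^{w(x)} θ₀(x)` has all
derivatives bounded (compact support). -/
theorem isCkBounded_exp_mul {θ₀ : E → ℝ} (hθ₀ : ContDiff ℝ ∞ θ₀) (hθ₀c : HasCompactSupport θ₀)
    {w : E → ℝ} (hw : ContDiff ℝ ∞ w) (n : ℕ) :
    ∃ A, IsCkBounded n A (fun x => Real.exp (w x) * θ₀ x) := by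
  have hs : ContDiff ℝ ∞ fun x => Real.exp (w x) * θ₀ x := (Real.contDiff_exp.comp hw).mul hθ₀
  have hc : HasCompactSupport fun x => Real.exp (w x) * θ₀ x := hθ₀c.mul_left
  have hj : ∀ j, ∃ C, ∀ x, ‖iteratedFDeriv ℝ j (fun x => Real.exp (w x) * θ₀ x) x‖ ≤ C := fun j =>
    ((hs.continuous_iteratedFDeriv (mod_cast le_top)).bounded_above_of_compact_support
      (hc.iteratedFDeriv j))
  choose C hC using hj
  refine ⟨∑ j ∈ Finset.range (n + 1), |C j|, hs.of_le (mod_cast le_top), fun j hj x => ?_⟩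
  exact ((hC j x).trans (le_abs_self _)).trans (Finset.single_le_sum (f := fun j => |C j|)
    (fun _ _ => abs_nonneg _) (Finset.mem_range.2 (Nat.lt_succ_of_le hj)))

/-- Anchor (registered sub-stub of stub W2): the conjugated datum on `ℝ³` (closed form). -/
theorem w2aux_conjDatum : ∀ (θ₀ w : EuclideanSpace ℝ (Fin 3) → ℝ), ContDiff ℝ ∞ θ₀ →
    HasCompactSupport θ₀ → ContDiff ℝ ∞ w → ∀ n : ℕ,
    ∃ A, IsCkBounded n A (fun x => Real.exp (w x) * θ₀ x) :=
  fun _ _ hθ₀ hθ₀c hw n => isCkBounded_exp_mul hθ₀ hθ₀c hw n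

end Conjugation

end Summit.NavierStokesRegularity.NavierStokesRegularity.Theorems.SelfMixingDichotomy.MixingPayoffBirth

end
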